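import Literature.MathematicalPhysics.QuantumFieldTheory.Balaban1983to89.B6Eq292MemberTwoScaleV1
import Literature.MathematicalPhysics.QuantumFieldTheory.Balaban1983to89.B6CubeWindowV1L0
import Literature.MathematicalPhysics.QuantumFieldTheory.Balaban1983to89.B6CubeWindowV1L3
import Literature.MathematicalPhysics.QuantumFieldTheory.Balaban1983to89.B6Cover236MultiLevelBlocksL0
import Literature.MathematicalPhysics.QuantumFieldTheory.Balaban1983to89.B6GlobalChartV1L0
import Literature.MathematicalPhysics.QuantumFieldTheory.Balaban1983to89.B6MultiLevelTorusOperatorL0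
import Literature.MathematicalPhysics.QuantumFieldTheory.Balaban1983to89.B6Prop26KLevelSkeletonV1L0
import Literature.MathematicalPhysics.QuantumFieldTheory.Balaban1983to89.B6Eq292MemberTorusV1
/-!
# `Balaban1983to89.B6Eq292MemberTorusV1L3` — RE-CENTRED-WINDOW TWIN (sub-row G-F3′-L0∕L3 of programme G-F3′-L0; UV3-NODE §26.3 (P2-L3); every odd `L ≥ 3`;
ruling of record `lit-balaban-r03/G-F3L0-PLAN.md` v1.5 §13 (B′), joints J9′–J11′, J14) of `B6Eq292MemberTorusV1L0`: the SAME declarations, names and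
statements over p21's re-centred root `B6CubeWindowV1L3` (window corner `x0C = S_j·(qc − ℓ) = ctr − (2L−1)S_j/2` — the cube's central block is
the middle block of its `2L`-block member torus, print p.238 «□ in the middle of □̃³ = T_□»; reach sub-window corner `x1C = x0C + (L−2)S_j`;
`PlacedC`; `eC`, `ρ`, `R ≥ 2L²`, `C = 9`, `M_c = 8S/3` UNCHANGED; the binder `(4 ≤ ℓ)` DROPPED).  J14: ONLY the window-dependent declarations are
re-declared here; every window-free declaration of the L0 twin and every `D`-free object of the lineage is consumed BY NAME.  No existing module is
touched; no fact is minted; standard axioms.  Unit `lit-balaban-p33` (gen 90), 2026-08-27.  THE TWIN'S DOCUMENTATION FOLLOWS VERBATIM (its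
«x₀ = ctr − L·S_j/2» / «L ≥ 5» sentences describe the twin; here the anchor is `(2L−1)S_j/2` and L ≥ 3).

statement-level skeleton of published theorems with citation tags; proofs where landed; nothing here is a claim about the Yang–Mills mass gap

# `Balaban1983to89.B6Eq292MemberTorusV1L0` — LEVEL-0 TWIN (programme G-F3′-L0, director-ym LINE №27 / UV3-NODE §24.5; plan `lit-balaban-r03/G-F3L0-PLAN.md`) of `B6Eq292MemberTorusV1`:
the same declarations, SAME NAMES AND STATEMENTS, for nested families WITH print's region `Λ₀ = T ∖ Ω₁` ADMITTED (structures
`B6MultiLevelBoxOperatorL0.Domains` / `B6MultiLevelTorusOperatorL0.TDomains`: levels `0, …, k`, the level-`0` block a single site, `Q′₀ = id`,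
finite weight `a₀` — print p.225 (2.14) «Σ_{j=0}^k … (Q′₀λ)(x) = λ(x), x ∈ Λ₀», p.229 «taking a sequence (2.1) … smallest possible domains B^j(Λ_j),
and considering the operator Δ_a defined by (2.19), (2.20) for this sequence»).  Every `D`-free object is the lineage's, consumed BY NAME; no existing
module is touched; no fact is minted.  Unit `lit-balaban-r03` (B6 fold owner, r03 gen 36); referee ref-4.  THE TWIN'S DOCUMENTATION FOLLOWS
VERBATIM (its «levels 1 … k» / «Ω₁ = X» sentences describe the twin; here `j` runs from `0` and `Ω₁` may be a proper subset).

# `Balaban1983to89.B6Eq292MemberTorusV1` — T. Bałaban, *Propagators and renormalization transformations for lattice gauge theories. II*,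
# Commun. Math. Phys. **96** (1984) 223–250 [Balaban1984PropagatorsII], (2.92) p. 239, LINES 1–2, FOR THE GENUINE MEMBER `M_□` OF A CUBE ON THE
# GLOBAL TORUS: the commutator `h_□M_□ − M_□h_□` of the conjugated, scaled, transplanted member operator `M_□ = τ_{−v}(s(□)•ε(Δ_□ + Q*a_□Q)ρ)τ_v` of
# `…B6CubeWindowV1L3.Ml` with the skeleton's `h_□ = hB`, in the `hdec` shape of `…B6Ineq2134KFamKLevelTorusL0.h2134_kFam_torus` — p22's member identity
# `…B6Eq292MemberTwoScaleV1.hdec_member_smul` TRANSPORTED through the bijective bond window (`transplant`) and the chart translation (`TB`)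

statement-level skeleton of published theorems with citation tags; proofs where landed; nothing here is a claim about the Yang–Mills mass gap

PDF held: `paper:balaban1984-cmp96-propagators-rt-ii` (journal page = PDF page + 222): p. 239 [PDF 17] ((2.90)–(2.92), (2.94)), p. 238 [PDF 16] (*"We take
the cube □̃³ and identify it with a torus, denoted by T_□"*), p. 226 [PDF 4] ((2.19)–(2.22): the operators on the torus); read from the tree transcriptions in
`…B6Eq292MemberTwoScaleV1` (p22 gen 18), `…B6CubeWindowV1` (r03 gen 20), `…B6Prop26ReachTransplant` (r03), `…B6TranslateTorusV1` (r03).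

CITATION HEADER (lean-in-tree rule) — WHAT IS REPRODUCED.  Phase-2 file of the `lit-balaban` typed skeleton (HOME `run/shared/lean/pub/lit-balaban/`), seat
**p38 gen 27**; B6 fold owner r03 gen 20's ask (seat INBOX 2026-08-23T05:29:32Z (2): *"hdec torus twin for the genuine members: YES PLEASE take it (p38) — the
member M_□ is `B6CubeWindowV1L3.Ml … = τ_(−v)·(sc • transplant W (chartBond tC posV dir x0C) (onFun (tC.D.lapV + Q*aQ)))·τ_v`"*); SKELETON rows **B6.Eq2.92** ×
**B6.Eq2.91** × **B6.Eq2.134** (cells only; decls of record untouched: (2.92) lines 1–2 on the member torus are p22's `hdec_member`, the member of the cube is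
r03's `Ml`, the (2.134) consumer is p38's `h2134_kFam_torus`).  THIS FILE = the per-cube input *«hdec»* of `h2134_kFam_torus` for r03's members:
* §1 **transport through a bijective window** (any carriers `X ⊇ W ≅ X′`): `extendOp_restrictOp_eq` (`ε(ρh) = h` for `supp h ⊂ W`), `transplant_mulOp`
  (`ε(h′·)ρ = (εh′)·`), `transplant_zero`, `transplant_sum`, **`hdec_transplant`** (an `hdec` identity on `X′` gives the `hdec` identity of the transplants:
  multipliers `h′, c_e, c₀, z ↦ ε(·)`, operators `M, E_e, N ↦ ε(·)ρ`);
* §2 **transport through a conjugation** `T ↦ UTV`, `VU = 1` (any carrier): **`hdec_conj`** (multipliers `h ↦ U(h·)V`, which for the translations `τ` is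
  `(τh)·` — `…B6TranslateTorusV1.TB_mul_mulOp`);
* §3 the genuine two-scale member `t` through its bond window chart `cB t x₀` (r03's `…B6AgreeLapV1Chart`): **`hdec_member_transplant`** — for EVERY bond
  function `h` of the global torus supported in the window and every unit `κ`, `h·(κ•ε(Δ_□ + Q*aQ)ρ) − (κ•ε(Δ_□ + Q*aQ)ρ)·h = (Σ_{e} c_e·εE_eρ − c₀·) +
  Σ_{k∈{()}} z·((κ•εNρ)h − h(κ•εNρ))` with `E_(λ,±) = ∇_λ^{(*)}`, `c_e = ε(κ•E_e(ρh))`, `c₀ = ε(κ•Δ(ρh))`, `N = Q*aQ`, `z = ε(−1)` (p22's `hdec_member_smul` at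
  `ρh`, `hdec_transplant`, `ε(ρh) = h`);
* §4 **THE CUBE** (r03's `…B6CubeWindowV1` letters `tC`, `x0C`, `sc`, `wC`, `hch`, `Ml`, the skeleton's `hB`): the per-cube decomposition data
  `EC`/`cfC`/`c0C`/`NC`/`zC` (defs with bodies: the conjugated transplants / translated extensions) and **`hdec_cube`**:
  `mulOp (hB c) * Ml c − Ml c * mulOp (hB c) = (Σ_{e ∈ univ} mulOp (cfC e) * EC e − mulOp c0C) + Σ_{k∈{()}} mulOp zC * (NC * mulOp (hB c) − mulOp (hB c) * NC)`
  — LITERALLY the hypothesis `hdec` of `h2134_kFam_torus` for `Ml := B6CubeWindowV1L3.Ml`, `h := hB` (index types `Fin (d+1) × Bool`, `Unit`, the same for all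
  cubes); `abs_zC_le` (`|z| ≤ 1`), `Ml_eq_add_NC` (`NC` is the `Q*aQ` part of `Ml`: `Ml = (Δ-part) + NC`).
No `def … : Prop`, no new hypothesis; defs with bodies (`EC`, `cfC`, `c0C`, `NC`, `zC`); standard axioms.

HONEST SCOPE / DIVERGENCES. (1) Operator algebra only: the SIZES of `cfC`, `c0C` (`s₁/(M·Lʲη)`, `s₂/(M(Lʲη)²)` from the (1.118) Lipschitz data of `h_□`,
p38's `…B6Partition118KLevelTorus*`) and the MAJORANTS of `EC e * Gl c`, `NC` on `geomT D` (r03's reach transplant `…B6FullWindowReachV1` pattern + p22's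
`ineq2133_DlaG`/`ineq2133_QaQ`) are NOT in this file — they are the remaining per-cube inputs `hEG`, `hcf`, `hc₀`, `hN` of `h2134_kFam_torus`. (2) Line 2 stays
ONE commutator partner `N = Q*aQ` with `z = −1` on the window (p22's reading; print expands it through `S_j`). (3) Hypotheses as r03's `hinvlC`: `M_h = L^a ≥ 8`,
`R ≥ 2L²`, placed cube (`PlacedC`), any `c′`, any weights.  Nothing on d = 4 or the continuum; NOT summit progress.  Unit `lit-balaban-p38` (gen 27), 2026-08-23.
-/

noncomputable section

open scoped BigOperators
open Finset

namespace Literature.MathematicalPhysics.QuantumFieldTheory.Balaban1983to89.B6Eq292MemberTorusV1L3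

open LatticeFieldCalculus
open B6Prop26Gluing (mulOp mulOp_apply)
open B6Prop26ReachTransplant (transplant restrictOp extendOp transplant_apply restrictOp_apply_of_injOn extendOp_apply transplant_mul_of_bij transplant_add transplant_sub transplant_smul chartBond)
open Literature.MathematicalPhysics.QuantumFieldTheory.Balaban1983to89.B6Eq292MemberTorusV1 (extendOp_restrictOp_eq transplant_mulOp transplant_zero transplant_sum hdec_transplant hdec_conj hdec_member_transplant conj_mulOp)

/-! ## §1  Transport of an `hdec` identity through a bijective window -/

section Transplant

variable {X X' : Type} [DecidableEq X'] [DecidableEq X] {W : Finset X} {e : X → X'}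

end Transplant

/-! ## §2  Transport of an `hdec` identity through a conjugation -/

section Conj

variable {X : Type}

/-- conjugates multiply (`VU = 1`). [cite: Balaban1984PropagatorsII, (2.19)–(2.22) p.226, dictionary] -/
private theorem conj_mul' {U V : Module.End ℝ (X → ℝ)} (hVU : V * U = 1) (A B : Module.End ℝ (X → ℝ)) :
    (U * A * V) * (U * B * V) = U * (A * B) * V := by
  calc (U * A * V) * (U * B * V) = U * A * (V * U) * B * V := by noncomm_ring
    _ = U * (A * B) * V := by rw [hVU]; noncomm_ring

/-- conjugates subtract. [folklore] -/
private theorem conj_sub' (U V A B : Module.End ℝ (X → ℝ)) : U * A * V - U * B * V = U * (A - B) * V := by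
  rw [mul_sub, sub_mul]

/-- conjugates add. [folklore] -/
private theorem conj_add' (U V A B : Module.End ℝ (X → ℝ)) : U * A * V + U * B * V = U * (A + B) * V := by
  rw [mul_add, add_mul]

/-- conjugates sum. [folklore] -/
private theorem conj_sum' (U V : Module.End ℝ (X → ℝ)) {ι : Type} (s : Finset ι) (T : ι → Module.End ℝ (X → ℝ)) :
    ∑ i ∈ s, U * T i * V = U * (∑ i ∈ s, T i) * V := by
  rw [Finset.mul_sum, Finset.sum_mul]

end Conj

/-! ## §3  The genuine two-scale member through its bond window chart -/

section Member

open B6Ineq2133TwoScaleV1 (onFun)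
open B6GlobalChartV1 (PV)
open B6Prop25TwoScaleCensus (TSIdx)
open B6AgreeLapV1Chart (cB eB)
open B6Eq292MemberTwoScaleV1 (hdec_member_smul)

variable {d ℓ : ℕ} {hd : 1 ≤ d + 1} {hL : Odd (ℓ + 1) ∧ 1 < ℓ + 1} {a₀ a₁ : ℝ} {m K : ℕ}
variable {t : TSIdx d (ℓ + 1) hd hL a₀ a₁} {x₀ : Fin (d + 1) → ℤ}
variable {hx₀ : ∀ μ, 0 ≤ x₀ μ} {hfit : ∀ μ, x₀ μ + (t.P.sitesPerDir 0 : ℕ) ≤ ((PV d ℓ m K hd hL).sitesPerDir 0 : ℕ)}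

end Member

/-! ## §4  The cube: `hdec` for `B6CubeWindowV1L3.Ml` and the skeleton's `hB` -/

section Cube

open B6Ineq2133TwoScaleV1 (onFun)
open B6GlobalChartV1 (PV)
open B6GlobalChartV1L0 (domT)
open B6SectAOperatorsV1 (BondIdx)
open B6Prop25TwoScaleCensus (TSIdx)
open B6AgreeLapV1Chart (cB eB posV mem_cB_W transplant_eB_eq)
open B6MultiLevelBoxOperator (N0)
open B6MultiLevelTorusOperatorL0 (TDomains)
open B6Cover236MultiLevelBlocksL0 (cubes)
open B6Eq238MultiLevelTorus (svec)
open B6TranslateV1 (trV)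
open B6TranslateTorusV1 (vch TB TB_mul_TB_neg TB_neg_mul_TB TB_mul_mulOp mulOp_eq_conj)
open B6Prop26KLevelSkeletonV1L0 (hB)
open B6CubeWindowV1L3 (x0C PlacedC)
open B6CubeWindowV1L3 (tC hx0 hfit hch_deep0 Ml MlC)
open B6CubeWindowV1L0 (sc wC hch trV_hB)

variable {d ℓ : ℕ} {hd : 1 ≤ d + 1} {hL : Odd (ℓ + 1) ∧ 1 < ℓ + 1} {a₀ a₁ : ℝ} {m K : ℕ} {Mh k R : ℕ} {P' : Fin (d + 1) → ℕ}
variable (hN : ∀ μ, N0 ℓ Mh k P' μ = (PV d ℓ m K hd hL).sitesPerDir 0) {D : TDomains d ℓ Mh k P' R} (hk : k ≤ m + K)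
  (hMh1 : 1 ≤ Mh) (hP4 : ∀ μ, 4 ≤ P' μ) {a : ℕ} (hMha : Mh = (ℓ + 1) ^ a) (c : ↥(cubes D.toDomains)) (ha : a₀ ≤ a₁)

/-- **THE FIRST-ORDER OPERATORS `E_e` OF THE CUBE** (`e = (λ, ±)`): the conjugated transplants of the member's `∇_λ` / `∇_λ*`.
[cite: Balaban1984PropagatorsII, (2.92) p.239 (line 1: «Σ_{b∈st(x)}(∂h_□)(b)(∂A_μ)(b)»), dictionary (charts)] -/
def EC (hpl : PlacedC ℓ k P' c.1) (w : BondIdx (domT hN D hk) → ℝ) (cf : ℝ) (e : Fin (d + 1) × Bool) :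
    Module.End ℝ (PBond (PV d ℓ m K hd hL) 0 → ℝ) :=
  TB (-vch Mh k (svec ℓ k c.1.1 c.1.2)) *
    transplant (cB (tC hN hk hMh1 hP4 c ha a (wC hN hk c w) cf) (x0C ℓ Mh k c.1) (hx0 hpl) (hfit hN hMh1 hP4 hMha c ha hpl)).W
      (eB (tC hN hk hMh1 hP4 c ha a (wC hN hk c w) cf) (x0C ℓ Mh k c.1))
      (onFun (if e.2 then (tC hN hk hMh1 hP4 c ha a (wC hN hk c w) cf).Dl e.1 else (tC hN hk hMh1 hP4 c ha a (wC hN hk c w) cf).Dla e.1)) *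
    TB (vch Mh k (svec ℓ k c.1.1 c.1.2))

/-- **THE COEFFICIENTS `c_e = s(□)·(E_eh_□)` OF THE CUBE** (`(∂h_□)(b)` of (2.92) line 1), read on the global torus: the translated extension of the member-frame
differences of `h_□`. [cite: Balaban1984PropagatorsII, (2.92) p.239 (line 1), (2.94) p.239 (rescaling), dictionary (charts)] -/
def cfC (hpl : PlacedC ℓ k P' c.1) (w : BondIdx (domT hN D hk) → ℝ) (cf : ℝ) (e : Fin (d + 1) × Bool) : PBond (PV d ℓ m K hd hL) 0 → ℝ :=
  trV (-vch Mh k (svec ℓ k c.1.1 c.1.2))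
    (extendOp (cB (tC hN hk hMh1 hP4 c ha a (wC hN hk c w) cf) (x0C ℓ Mh k c.1) (hx0 hpl) (hfit hN hMh1 hP4 hMha c ha hpl)).W
      (eB (tC hN hk hMh1 hP4 c ha a (wC hN hk c w) cf) (x0C ℓ Mh k c.1))
      (sc hMh1 hP4 c cf • onFun (if e.2 then (tC hN hk hMh1 hP4 c ha a (wC hN hk c w) cf).Dl e.1 else (tC hN hk hMh1 hP4 c ha a (wC hN hk c w) cf).Dla e.1)
        (restrictOp (cB (tC hN hk hMh1 hP4 c ha a (wC hN hk c w) cf) (x0C ℓ Mh k c.1) (hx0 hpl) (hfit hN hMh1 hP4 hMha c ha hpl)).W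
          (eB (tC hN hk hMh1 hP4 c ha a (wC hN hk c w) cf) (x0C ℓ Mh k c.1)) (hch hN hMh1 hP4 c))))

/-- **THE ZEROTH-ORDER COEFFICIENT `c₀ = s(□)·(Δh_□)`** of (2.92) line 1, read on the global torus.
[cite: Balaban1984PropagatorsII, (2.92) p.239 (line 1: «(Δh_□)(x)A_μ(x)»), (2.94) p.239, dictionary (charts)] -/
def c0C (hpl : PlacedC ℓ k P' c.1) (w : BondIdx (domT hN D hk) → ℝ) (cf : ℝ) : PBond (PV d ℓ m K hd hL) 0 → ℝ :=
  trV (-vch Mh k (svec ℓ k c.1.1 c.1.2))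
    (extendOp (cB (tC hN hk hMh1 hP4 c ha a (wC hN hk c w) cf) (x0C ℓ Mh k c.1) (hx0 hpl) (hfit hN hMh1 hP4 hMha c ha hpl)).W
      (eB (tC hN hk hMh1 hP4 c ha a (wC hN hk c w) cf) (x0C ℓ Mh k c.1))
      (sc hMh1 hP4 c cf • onFun (tC hN hk hMh1 hP4 c ha a (wC hN hk c w) cf).lapTS
        (restrictOp (cB (tC hN hk hMh1 hP4 c ha a (wC hN hk c w) cf) (x0C ℓ Mh k c.1) (hx0 hpl) (hfit hN hMh1 hP4 hMha c ha hpl)).W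
          (eB (tC hN hk hMh1 hP4 c ha a (wC hN hk c w) cf) (x0C ℓ Mh k c.1)) (hch hN hMh1 hP4 c))))

/-- **THE LINE-2 PARTNER `N = s(□)·ε(Q*a_□Q)ρ` OF THE CUBE**, conjugated to the global frame (the `Q*aQ` part of `B6CubeWindowV1L3.Ml`).
[cite: Balaban1984PropagatorsII, (2.92) p.239 (line 2), (2.90) p.239, dictionary (charts)] -/
def NC (hpl : PlacedC ℓ k P' c.1) (w : BondIdx (domT hN D hk) → ℝ) (cf : ℝ) : Module.End ℝ (PBond (PV d ℓ m K hd hL) 0 → ℝ) :=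
  TB (-vch Mh k (svec ℓ k c.1.1 c.1.2)) *
    (sc hMh1 hP4 c cf • transplant (cB (tC hN hk hMh1 hP4 c ha a (wC hN hk c w) cf) (x0C ℓ Mh k c.1) (hx0 hpl) (hfit hN hMh1 hP4 hMha c ha hpl)).W
      (chartBond (tC hN hk hMh1 hP4 c ha a (wC hN hk c w) cf) posV PBond.dir (x0C ℓ Mh k c.1))
      (onFun (LinearMap.adjoint (tC hN hk hMh1 hP4 c ha a (wC hN hk c w) cf).D.Q ∘ₗ (tC hN hk hMh1 hP4 c ha a (wC hN hk c w) cf).D.a ∘ₗ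
        (tC hN hk hMh1 hP4 c ha a (wC hN hk c w) cf).D.Q))) *
    TB (vch Mh k (svec ℓ k c.1.1 c.1.2))

/-- **THE LINE-2 MULTIPLIER `z = −1` ON THE (translated) WINDOW**, `0` off it. [cite: Balaban1984PropagatorsII, (2.92) p.239 (line 2: the sign of «− a(Lʲη)⁻²Q_j*S_j(∂h_□)»), dictionary] -/
def zC (hpl : PlacedC ℓ k P' c.1) (w : BondIdx (domT hN D hk) → ℝ) (cf : ℝ) : PBond (PV d ℓ m K hd hL) 0 → ℝ :=
  trV (-vch Mh k (svec ℓ k c.1.1 c.1.2))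
    (extendOp (cB (tC hN hk hMh1 hP4 c ha a (wC hN hk c w) cf) (x0C ℓ Mh k c.1) (hx0 hpl) (hfit hN hMh1 hP4 hMha c ha hpl)).W
      (eB (tC hN hk hMh1 hP4 c ha a (wC hN hk c w) cf) (x0C ℓ Mh k c.1)) (fun _ => (-1 : ℝ)))

/-- `|z| ≤ 1` (the hypothesis `hz` of `h2134_kFam_torus`). [cite: Balaban1984PropagatorsII, (2.92) p.239 (line 2), bookkeeping] -/
theorem abs_zC_le (hpl : PlacedC ℓ k P' c.1) (w : BondIdx (domT hN D hk) → ℝ) (cf : ℝ) (b : PBond (PV d ℓ m K hd hL) 0) :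
    |zC hN hk hMh1 hP4 hMha c ha hpl w cf b| ≤ 1 := by
  unfold zC
  rw [B6TranslateV1.trV_apply, extendOp_apply]
  split_ifs <;> simp

/-- **`hdec` OF `h2134_kFam_torus` FOR THE GENUINE MEMBER OF THE CUBE**: with r03's `M_□ = B6CubeWindowV1L3.Ml` and the skeleton's `h_□ = hB`,
`h_□M_□ − M_□h_□ = (Σ_{e} c_e·E_e − c₀·) + Σ_{k∈{()}} z·(Nh_□ − h_□N)` with this file's `EC`, `cfC`, `c0C`, `NC`, `zC` — (2.92) lines 1–2 for the member
(p22's `hdec_member_smul`) transported through the bijective bond window of `t(□)` (§1, §3) and the chart translation `τ_{±v}` (§2; `τ_v hB = hch`,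
r03's `trV_hB`). Hypotheses as r03's `hinvlC` (`M_h = L^a ≥ 8`, `R ≥ 2L²`, placed cube: `supp h_□ ⊂` window, `hch_deep0`).
[cite: Balaban1984PropagatorsII, (2.92) p.239 (lines 1–2), (2.90)–(2.91), (2.94) p.239, p.238 (T_□ = □̃³), (2.19) p.226] -/
theorem hdec_cube (hM8 : 8 ≤ Mh) (hR2 : 2 * (ℓ + 1) ^ 2 ≤ R) (hpl : PlacedC ℓ k P' c.1) (w : BondIdx (domT hN D hk) → ℝ) (cf : ℝ) :
    mulOp (hB hN D c) * Ml hN hk hMh1 hP4 hMha c ha hpl w cf - Ml hN hk hMh1 hP4 hMha c ha hpl w cf * mulOp (hB hN D c) =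
      (∑ e ∈ (Finset.univ : Finset (Fin (d + 1) × Bool)),
          mulOp (cfC hN hk hMh1 hP4 hMha c ha hpl w cf e) * EC hN hk hMh1 hP4 hMha c ha hpl w cf e -
        mulOp (c0C hN hk hMh1 hP4 hMha c ha hpl w cf)) +
      ∑ _k ∈ ({()} : Finset Unit), mulOp (zC hN hk hMh1 hP4 hMha c ha hpl w cf) *
        (NC hN hk hMh1 hP4 hMha c ha hpl w cf * mulOp (hB hN D c) - mulOp (hB hN D c) * NC hN hk hMh1 hP4 hMha c ha hpl w cf) := by
  -- the chart-frame identity for `h^ch_□` (supported in the window) and the unit `s(□)`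
  have hch_supp : ∀ b, hch hN hMh1 hP4 c b ≠ 0 →
      b ∈ (cB (tC hN hk hMh1 hP4 c ha a (wC hN hk c w) cf) (x0C ℓ Mh k c.1) (hx0 hpl) (hfit hN hMh1 hP4 hMha c ha hpl)).W :=
    fun b hb => mem_cB_W.2 (hch_deep0 hN hMh1 hP4 hMha c ha hM8 hR2 hb)
  have key := hdec_member_transplant (t := tC hN hk hMh1 hP4 c ha a (wC hN hk c w) cf) (x₀ := x0C ℓ Mh k c.1) (hx₀ := hx0 hpl)
    (hfit := hfit hN hMh1 hP4 hMha c ha hpl) (sc hMh1 hP4 c cf) (hch hN hMh1 hP4 c) hch_supp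
  -- conjugate by the chart translation
  have conj := hdec_conj (U := TB (-vch (ℓ := ℓ) (m := m) (K := K) (hd := hd) (hL := hL) Mh k (svec ℓ k c.1.1 c.1.2)))
    (V := TB (vch Mh k (svec ℓ k c.1.1 c.1.2))) (TB_mul_TB_neg _) key
  -- the conjugated multiplication by `h^ch_□` is the multiplication by `hB`
  have hh : TB (-vch (ℓ := ℓ) (m := m) (K := K) (hd := hd) (hL := hL) Mh k (svec ℓ k c.1.1 c.1.2)) * mulOp (hch hN hMh1 hP4 c) *
      TB (vch Mh k (svec ℓ k c.1.1 c.1.2)) = mulOp (hB hN D c) := by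
    rw [← trV_hB hN hMh1 hP4 c, ← mulOp_eq_conj]
  have hM : TB (-vch (ℓ := ℓ) (m := m) (K := K) (hd := hd) (hL := hL) Mh k (svec ℓ k c.1.1 c.1.2)) *
      (sc hMh1 hP4 c cf • transplant (cB (tC hN hk hMh1 hP4 c ha a (wC hN hk c w) cf) (x0C ℓ Mh k c.1) (hx0 hpl) (hfit hN hMh1 hP4 hMha c ha hpl)).W
        (eB (tC hN hk hMh1 hP4 c ha a (wC hN hk c w) cf) (x0C ℓ Mh k c.1))
        (onFun ((tC hN hk hMh1 hP4 c ha a (wC hN hk c w) cf).D.lapV +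
          LinearMap.adjoint (tC hN hk hMh1 hP4 c ha a (wC hN hk c w) cf).D.Q ∘ₗ (tC hN hk hMh1 hP4 c ha a (wC hN hk c w) cf).D.a ∘ₗ
            (tC hN hk hMh1 hP4 c ha a (wC hN hk c w) cf).D.Q))) *
      TB (vch Mh k (svec ℓ k c.1.1 c.1.2)) = Ml hN hk hMh1 hP4 hMha c ha hpl w cf := by
    rw [Ml, MlC, transplant_eB_eq]
  rw [hh, hM] at conj
  rw [conj]
  simp only [conj_mulOp, EC, cfC, c0C, NC, zC, transplant_eB_eq]

/-- `NC` is the `Q*a_□Q` part of `Ml`: `Ml = τ_{−v}(s(□)•ε(Δ_□)ρ)τ_v + NC`. [cite: Balaban1984PropagatorsII, (2.90) p.239 («Δ − ∂P_□∂* + Q*aQ»), dictionary (charts)] -/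
theorem Ml_eq_add_NC (hpl : PlacedC ℓ k P' c.1) (w : BondIdx (domT hN D hk) → ℝ) (cf : ℝ) :
    Ml hN hk hMh1 hP4 hMha c ha hpl w cf =
      TB (-vch Mh k (svec ℓ k c.1.1 c.1.2)) *
        (sc hMh1 hP4 c cf • transplant (cB (tC hN hk hMh1 hP4 c ha a (wC hN hk c w) cf) (x0C ℓ Mh k c.1) (hx0 hpl) (hfit hN hMh1 hP4 hMha c ha hpl)).W
          (chartBond (tC hN hk hMh1 hP4 c ha a (wC hN hk c w) cf) posV PBond.dir (x0C ℓ Mh k c.1))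
          (onFun (tC hN hk hMh1 hP4 c ha a (wC hN hk c w) cf).D.lapV)) *
        TB (vch Mh k (svec ℓ k c.1.1 c.1.2)) + NC hN hk hMh1 hP4 hMha c ha hpl w cf := by
  rw [Ml, MlC, NC, B6AgreeLapV1Chart.onFun_add, transplant_add, smul_add, mul_add, add_mul]

end Cube

end Literature.MathematicalPhysics.QuantumFieldTheory.Balaban1983to89.B6Eq292MemberTorusV1L3
end
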